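import Literature.Analysis.FluidPDE.CKNPressureDuality
import Literature.Analysis.FluidPDE.HessianLaplacianLpProofs
import Literature.Analysis.FluidPDE.CKNLocalEnergyEstimate
import Literature.Analysis.FunctionSpaces.SobolevPoincareBallSix
import HarnessLib

/-!
# The Calderón–Zygmund term of the local pressure estimate (Robinson–Rodrigo–Sadowski 2016, Lemma 16.7)

Analysis/FluidPDE support file (all results proved) in the decomposition of the named fact
`Literature.Analysis.FluidPDE.ckn_epsilon_regularity` (`PartialRegularity.lean`, ns.S12:
Caffarelli–Kohn–Nirenberg 1982, Proposition 2) through the decomposition target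
`Literature.Analysis.FluidPDE.pressureEstimate` (`CKNEpsilonRegularityAssembly.lean`:
Robinson–Rodrigo–Sadowski 2016, Lemma 16.7, after Kukavica 2009,
`D(θr) ≤ κ₅ θ^{-3/2} A(r)^{3/4} E(r)^{3/4} + κ₆ θ D(r)`).

The printed proof (pp. 252–253) writes `-Δp = ∂ᵢ∂ⱼ Uᵢⱼ`, `Uᵢⱼ = uᵢ(uⱼ - (uⱼ)₁)` (using
`div u = 0`), localises with a cut-off and the Newtonian kernel, and bounds the singular part
`p₁ = Tᵢⱼ(ηUᵢⱼ)` by the Calderón–Zygmund theorem,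
`‖p₁‖_{L^{3/2}} ≤ C ‖u‖_{L²(B₁)} ‖u - (u)₁‖_{L⁶(B₁)} ≤ C ‖u‖_{L²(B₁)} ‖∇u‖_{L²(B₁)}`, before
Hölder in time gives the factor `θ^{1/2}` of `θ^{-3/2} = θ^{-2} θ^{1/2}`. Here, as in the tree's
treatment of Lemarié-Rieusset's (13.20) (`CKNPressureDuality`), the kernel is moved onto the test
function: for `θ' ∈ C_c^∞(I × B(x_B, R))` and `Θ(t,·) = N_{ρ/2,ρ}[θ'(t,·)]` the Calderón–Zygmund
term is `∫∫ D²ₓΘ(u, u)`, and this file proves its bound in the **mean-subtracted, `L² × L⁶`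
form** of Lemma 16.7:

* `ae_integral_hessian_apply_basisFun_eq_zero` — for a weakly divergence-free `u` and a
  space–time test function `Ψ`, for a.e. `t`: `∫ D²Ψ(t)(x)(u(t,x), eₖ) dx = 0` (test the
  divergence condition with `∂ₖΨ`), whence the mean `(u)₁(t)` may be subtracted in the second
  slot;
* `lintegral_hessian_newtonNearPotential_apply_le` — slice-wise,
  `∫ |D²Θ(t)(v, w)| ≤ 9 C₃ ‖θ'(t)‖_{L³} ‖|v||w|‖_{L^{3/2}(B(x_B,R+ρ))}` from the `L³` operator
  bound for the Hessian of the truncated Newtonian potential (Stein 1970, III §1.3 Prop. 3, the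
  tree's **theorem** `stein1970_hessian_Lp_bound_holds_fin3`);
* `enorm_integral_hessian_le_meanZero_unitScale` — for `u` with weak spatial gradient `G` on
  `Q₁ = (-1,0) × B₁`, weakly divergence free, and `θ'` supported in `Q_θ = (-θ², 0) × B_θ`,
  `θ ≤ 1/2`, `ρ = 1/2`:
  `‖∫∫_{Q₁} D²Θ(u,u)‖ ≤ 9 C₃ C_SP A(1)^{1/2} E(1)^{1/2} θ^{1/3} ‖θ'‖_{L³(Q_θ)}`
  (Hölder `(3; 2, 6)` on each slice, the Sobolev–Poincaré inequality
  `‖u - (u)₁‖_{L⁶(B₁)} ≤ C_SP ‖∇u‖_{L²(B₁)}` of `SobolevPoincareBallSix`, and Hölder in time over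
  `(-θ², 0)`).

## References

* J. C. Robinson, J. L. Rodrigo, W. Sadowski, *The three-dimensional Navier–Stokes equations*,
  Cambridge Studies in Advanced Mathematics 157 (2016), Lemma 16.7 and its proof, pp. 251–253.
* I. Kukavica, *Partial regularity results for solutions of the Navier–Stokes system*, in
  *Partial differential equations and fluid mechanics*, LMS Lecture Notes 364 (2009), 121–145.
* E. M. Stein, *Singular integrals and differentiability properties of functions* (1970),
  Ch. III §1.3, Prop. 3.
-/

noncomputable section

open MeasureTheory Set Function Filter Topology TopologicalSpace Metric InnerProductSpace Module
open scoped ENNReal NNReal RealInnerProductSpace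

namespace Literature.Analysis.FluidPDE

/-! ### Bilinear forms in the coordinates of the standard basis -/

section Bilinear

/-- Expansion of a continuous bilinear form on `ℝ³` in the standard orthonormal basis:
`L(v, w) = ∑ᵢⱼ ⟪v, eᵢ⟫ ⟪w, eⱼ⟫ L(eᵢ, eⱼ)`. [folklore] -/
theorem clm_apply_apply_eq_sum_basisFun
    (L : EuclideanSpace ℝ (Fin 3) →L[ℝ] EuclideanSpace ℝ (Fin 3) →L[ℝ] ℝ)
    (v w : EuclideanSpace ℝ (Fin 3)) :
    L v w = ∑ i, ∑ j, ⟪v, EuclideanSpace.basisFun (Fin 3) ℝ i⟫ *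
      ⟪w, EuclideanSpace.basisFun (Fin 3) ℝ j⟫ *
      L (EuclideanSpace.basisFun (Fin 3) ℝ i) (EuclideanSpace.basisFun (Fin 3) ℝ j) := by
  set e := EuclideanSpace.basisFun (Fin 3) ℝ with he
  have hv : v = ∑ i, ⟪v, e i⟫ • e i := by
    conv_lhs => rw [← e.sum_repr' v]
    exact Finset.sum_congr rfl fun i _ => by rw [real_inner_comm]
  have hw : w = ∑ j, ⟪w, e j⟫ • e j := by
    conv_lhs => rw [← e.sum_repr' w]
    exact Finset.sum_congr rfl fun j _ => by rw [real_inner_comm]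
  have h1 : L v = ∑ i, ⟪v, e i⟫ • L (e i) := by
    conv_lhs => rw [hv]
    rw [map_sum]
    exact Finset.sum_congr rfl fun i _ => by rw [map_smul]
  have h2 : ∀ i, L (e i) w = ∑ j, ⟪w, e j⟫ * L (e i) (e j) := fun i => by
    conv_lhs => rw [hw]
    rw [map_sum]
    exact Finset.sum_congr rfl fun j _ => by rw [map_smul, smul_eq_mul]
  rw [h1, FunLike.coe_sum, Finset.sum_apply]
  refine Finset.sum_congr rfl fun i _ => ?_
  rw [FunLike.coe_smul, Pi.smul_apply, h2 i, smul_eq_mul, Finset.mul_sum]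
  exact Finset.sum_congr rfl fun j _ => by ring

/-- Pointwise bound of a bilinear form by its entries: `‖L(v,w)‖ ≤ ∑ᵢⱼ ‖v‖ ‖w‖ ‖L(eᵢ,eⱼ)‖`.
[folklore] -/
theorem enorm_clm_apply_apply_le_sum
    (L : EuclideanSpace ℝ (Fin 3) →L[ℝ] EuclideanSpace ℝ (Fin 3) →L[ℝ] ℝ)
    (v w : EuclideanSpace ℝ (Fin 3)) :
    ‖L v w‖ₑ ≤ ∑ i, ∑ j, ‖v‖ₑ * ‖w‖ₑ *
      ‖L (EuclideanSpace.basisFun (Fin 3) ℝ i) (EuclideanSpace.basisFun (Fin 3) ℝ j)‖ₑ := by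
  set e := EuclideanSpace.basisFun (Fin 3) ℝ with he
  rw [clm_apply_apply_eq_sum_basisFun L v w]
  refine (enorm_sum_le _ _).trans (Finset.sum_le_sum fun i _ => ?_)
  refine (enorm_sum_le _ _).trans (Finset.sum_le_sum fun j _ => ?_)
  rw [enorm_mul, enorm_mul]
  gcongr
  · rw [← ofReal_norm, ← ofReal_norm]
    refine ENNReal.ofReal_le_ofReal ((norm_inner_le_norm _ _).trans ?_)
    rw [e.orthonormal.1 i, mul_one]
  · rw [← ofReal_norm, ← ofReal_norm]
    refine ENNReal.ofReal_le_ofReal ((norm_inner_le_norm _ _).trans ?_)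
    rw [e.orthonormal.1 j, mul_one]

/-- Pointwise bound of a bilinear form by its entries, real form:
`‖L(v,w)‖ ≤ (∑ᵢⱼ ‖L(eᵢ,eⱼ)‖) ‖v‖ ‖w‖`. [folklore] -/
theorem norm_clm_apply_apply_le_sum_mul
    (L : EuclideanSpace ℝ (Fin 3) →L[ℝ] EuclideanSpace ℝ (Fin 3) →L[ℝ] ℝ)
    (v w : EuclideanSpace ℝ (Fin 3)) :
    ‖L v w‖ ≤ (∑ i, ∑ j,
      ‖L (EuclideanSpace.basisFun (Fin 3) ℝ i) (EuclideanSpace.basisFun (Fin 3) ℝ j)‖) * ‖v‖ * ‖w‖ := by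
  set e := EuclideanSpace.basisFun (Fin 3) ℝ with he
  rw [clm_apply_apply_eq_sum_basisFun L v w, Finset.sum_mul, Finset.sum_mul]
  refine (norm_sum_le _ _).trans (Finset.sum_le_sum fun i _ => ?_)
  rw [Finset.sum_mul, Finset.sum_mul]
  refine (norm_sum_le _ _).trans (Finset.sum_le_sum fun j _ => ?_)
  rw [norm_mul, norm_mul]
  have h1 : ‖⟪v, e i⟫‖ ≤ ‖v‖ := (norm_inner_le_norm _ _).trans (by rw [e.orthonormal.1 i, mul_one])
  have h2 : ‖⟪w, e j⟫‖ ≤ ‖w‖ := (norm_inner_le_norm _ _).trans (by rw [e.orthonormal.1 j, mul_one])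
  calc ‖⟪v, e i⟫‖ * ‖⟪w, e j⟫‖ * ‖L (e i) (e j)‖ ≤ ‖v‖ * ‖w‖ * ‖L (e i) (e j)‖ := by
        gcongr
    _ = ‖L (e i) (e j)‖ * ‖v‖ * ‖w‖ := by ring

/-- Mixed second derivatives as entries of the second Fréchet derivative:
`∂_b(∂ₐ g)(x) = D²g(x)(b)(a)` for `g ∈ C²`. [folklore] -/
theorem fderiv_apply_const_apply_eq {g : EuclideanSpace ℝ (Fin 3) → ℝ} (hg : ContDiff ℝ 2 g)
    (x a b : EuclideanSpace ℝ (Fin 3)) :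
    fderiv ℝ (fun y => fderiv ℝ g y a) x b = fderiv ℝ (fderiv ℝ g) x b a := by
  have hd : DifferentiableAt ℝ (fderiv ℝ g) x :=
    ((hg.fderiv_right (m := 1) le_rfl).differentiable one_ne_zero) x
  rw [fderiv_clm_apply hd (differentiableAt_const a)]
  simp

end Bilinear

/-! ### A Hölder inequality -/

section Holder

variable {α : Type*} [MeasurableSpace α]

/-- `(∫ (fg)^{3/2})^{2/3} ≤ (∫ f²)^{1/2} (∫ g⁶)^{1/6}` (Hölder with exponents `4/3` and `4` for
`f^{3/2}`, `g^{3/2}`). [folklore] -/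
theorem lintegral_mul_rpow_threeHalves_le (μ : Measure α) {f g : α → ℝ≥0∞}
    (hf : AEMeasurable f μ) (hg : AEMeasurable g μ) :
    (∫⁻ x, (f x * g x) ^ (3 / 2 : ℝ) ∂μ) ^ (2 / 3 : ℝ) ≤
      (∫⁻ x, f x ^ (2 : ℝ) ∂μ) ^ (1 / 2 : ℝ) * (∫⁻ x, g x ^ (6 : ℝ) ∂μ) ^ (1 / 6 : ℝ) := by
  have hpq : Real.HolderConjugate (4 / 3) 4 := Real.holderConjugate_iff.2 ⟨by norm_num, by norm_num⟩
  have h := ENNReal.lintegral_mul_le_Lp_mul_Lq μ hpq (hf.pow_const (3 / 2 : ℝ))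
    (hg.pow_const (3 / 2 : ℝ))
  have e1 : ∀ x, (f x ^ (3 / 2 : ℝ)) ^ (4 / 3 : ℝ) = f x ^ (2 : ℝ) := fun x => by
    rw [← ENNReal.rpow_mul]; norm_num
  have e2 : ∀ x, (g x ^ (3 / 2 : ℝ)) ^ (4 : ℝ) = g x ^ (6 : ℝ) := fun x => by
    rw [← ENNReal.rpow_mul]; norm_num
  have e0 : ∀ x, (f x * g x) ^ (3 / 2 : ℝ) = f x ^ (3 / 2 : ℝ) * g x ^ (3 / 2 : ℝ) := fun x =>
    ENNReal.mul_rpow_of_nonneg _ _ (by norm_num)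
  simp only [Pi.mul_apply, e1, e2] at h
  simp_rw [e0]
  calc (∫⁻ x, f x ^ (3 / 2 : ℝ) * g x ^ (3 / 2 : ℝ) ∂μ) ^ (2 / 3 : ℝ)
      ≤ ((∫⁻ x, f x ^ (2 : ℝ) ∂μ) ^ (1 / (4 / 3) : ℝ) * (∫⁻ x, g x ^ (6 : ℝ) ∂μ) ^ (1 / 4 : ℝ)) ^
          (2 / 3 : ℝ) := ENNReal.rpow_le_rpow h (by norm_num)
    _ = _ := by
        rw [ENNReal.mul_rpow_of_nonneg _ _ (by norm_num), ← ENNReal.rpow_mul, ← ENNReal.rpow_mul]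
        norm_num

end Holder

/-! ### Divergence-free slices kill constant vectors in the Hessian pairing -/

section MeanZero

/-- **Weakly divergence-free fields against Hessians.** Let `u ∈ L¹_loc(Q)` be weakly divergence
free on `Q` and `Ψ ∈ C_c^∞(Q)`. Then for a.e. `t` and every standard basis vector `eₖ`,
`∫ D²Ψ(t)(x)(u(t,x))(eₖ) dx = 0`: the divergence condition tested with the space–time test
function `∂ₖΨ` (Robinson–Rodrigo–Sadowski 2016, p. 252: "`-Δp = ∂ᵢ∂ⱼ Uᵢⱼ` since `(uⱼ)₁` is a
constant", i.e. `∂ᵢ∂ⱼ(uᵢ cⱼ) = 0` for `div u = 0`). [cite: RobinsonRodrigoSadowski2016, proof of Lemma 16.7 p. 252] -/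
theorem ae_integral_hessian_apply_basisFun_eq_zero
    {Q : Opens (ℝ × EuclideanSpace ℝ (Fin 3))}
    {u : ℝ → EuclideanSpace ℝ (Fin 3) → EuclideanSpace ℝ (Fin 3)}
    (hu : LocallyIntegrableOn (uncurry u) (Q : Set (ℝ × EuclideanSpace ℝ (Fin 3))) volume)
    (hdiv : ∀ ϑ : ℝ → EuclideanSpace ℝ (Fin 3) → ℝ, IsSpaceTimeTestOn Q ϑ →
      ∫ z in (Q : Set (ℝ × EuclideanSpace ℝ (Fin 3))), ⟪u z.1 z.2, gradient (ϑ z.1) z.2⟫ = 0)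
    {Ψ : ℝ → EuclideanSpace ℝ (Fin 3) → ℝ} (hΨ : IsSpaceTimeTestOn Q Ψ) :
    ∀ᵐ t ∂(volume : Measure ℝ), ∀ k : Fin 3,
      ∫ x, fderiv ℝ (fderiv ℝ (Ψ t)) x (u t x) (EuclideanSpace.basisFun (Fin 3) ℝ k) = 0 := by
  set e := EuclideanSpace.basisFun (Fin 3) ℝ with he
  have hΨ2 : ∀ t, ContDiff ℝ 2 (Ψ t) := fun t => contDiff_infty.1 (hΨ.contDiff_slice t) 2
  have hg := hΨ.gradient_isSpaceTimeTestOn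
  refine ae_all_iff.2 fun k => ?_
  -- the test function `∂ₖΨ = ⟪∇Ψ, eₖ⟫`
  set Φ : ℝ → EuclideanSpace ℝ (Fin 3) → ℝ := fun t y => fderiv ℝ (Ψ t) y (e k) with hΦ
  have hΦeq : uncurry Φ = fun z => ⟪uncurry (fun t x => gradient (Ψ t) x) z, e k⟫ := by
    funext z
    simp only [hΦ, uncurry, gradient, InnerProductSpace.toDual_symm_apply]
  have hΦtest : IsSpaceTimeTestOn Q Φ := by
    refine ⟨?_, ?_, ?_⟩
    · rw [hΦeq]; exact ContDiff.inner ℝ hg.contDiff contDiff_const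
    · rw [hΦeq]
      exact hg.hasCompactSupport.mono fun z hz => by
        intro h0
        exact hz (by simp [h0])
    · refine Subset.trans (closure_mono fun z hz => ?_) hg.tsupport_subset
      rw [hΦeq] at hz
      intro h0
      exact hz (by simp [h0])
  have hae := ae_integral_inner_gradient_eq_zero hu hdiv hΦtest
  filter_upwards [hae] with t ht
  have hid : ∀ x, ⟪u t x, gradient (Φ t) x⟫ = fderiv ℝ (fderiv ℝ (Ψ t)) x (u t x) (e k) := by
    intro x
    rw [real_inner_comm, gradient, InnerProductSpace.toDual_symm_apply]
    exact congrArg (fun L : EuclideanSpace ℝ (Fin 3) →L[ℝ] ℝ => L (u t x))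
      (show fderiv ℝ (Φ t) x = (fderiv ℝ (fderiv ℝ (Ψ t)) x).flip (e k) from by
        ext w
        rw [ContinuousLinearMap.flip_apply, ← fderiv_apply_const_apply_eq (hΨ2 t) x (e k) w])
  simp_rw [hid] at ht
  exact ht

end MeanZero

/-! ### The slice-wise Calderón–Zygmund bound -/

section SliceCZ

/-- **Slice-wise Calderón–Zygmund bound for the Hessian pairing.** Let `C₃` be a constant for
which `‖∂ₐ∂_b N_{r/2,r}[g]‖_{L³} ≤ C₃ ‖g‖_{L³}` (`g ∈ C²_c`, `|a|, |b| ≤ 1`; the conclusion of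
`stein1970_hessian_Lp_bound.hessian_newtonNearPotential_half` at exponent `3`), let
`θ' ∈ C_c^∞(I × B(x_B, R))`, `ρ > 0`, `Θ(t,·) = N_{ρ/2,ρ}[θ'(t,·)]`. Then for every `t` and all
fields `v, w` measurable on `B(x_B, R + ρ)`,
`∫ |D²Θ(t)(x)(v(x), w(x))| dx ≤ 9 C₃ ‖θ'(t)‖_{L³} ‖|v||w|‖_{L^{3/2}(B(x_B, R+ρ))}`
(`|D²Θ(v,w)| ≤ |v||w| ∑ᵢⱼ |∂ᵢ∂ⱼΘ|`, `D²Θ(t,·)` vanishes off `B(x_B, R + ρ)`, Hölder with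
exponents `3/2, 3`; Robinson–Rodrigo–Sadowski 2016, p. 252, the bound for `p₁`).
[cite: RobinsonRodrigoSadowski2016, proof of Lemma 16.7 p. 252] -/
theorem lintegral_hessian_newtonNearPotential_apply_le {C₃ : ℝ≥0}
    (hC₃ : ∀ ⦃r : ℝ⦄, 0 < r → ∀ ⦃g : EuclideanSpace ℝ (Fin 3) → ℝ⦄, ContDiff ℝ 2 g →
      HasCompactSupport g → ∀ a b : EuclideanSpace ℝ (Fin 3), ‖a‖ ≤ 1 → ‖b‖ ≤ 1 →
        eLpNorm (fun x => fderiv ℝ (fun y => fderiv ℝ (newtonNearPotential (r / 2) r g) y a) x b)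
            3 volume ≤ C₃ * eLpNorm g 3 volume)
    {ρ a b R : ℝ} {xB : EuclideanSpace ℝ (Fin 3)} {θ' : ℝ → EuclideanSpace ℝ (Fin 3) → ℝ}
    (hρ : 0 < ρ)
    (hθ' : IsSpaceTimeTestOn (⟨Ioo a b ×ˢ ball xB R, isOpen_Ioo.prod isOpen_ball⟩ :
      Opens (ℝ × EuclideanSpace ℝ (Fin 3))) θ')
    (t : ℝ) {v w : EuclideanSpace ℝ (Fin 3) → EuclideanSpace ℝ (Fin 3)}
    (hv : AEStronglyMeasurable v (volume.restrict (ball xB (R + ρ))))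
    (hw : AEStronglyMeasurable w (volume.restrict (ball xB (R + ρ)))) :
    ∫⁻ x, ‖fderiv ℝ (fderiv ℝ (newtonNearPotential (ρ / 2) ρ (θ' t))) x (v x) (w x)‖ₑ ≤
      9 * C₃ * (∫⁻ x, ‖θ' t x‖ₑ ^ (3 : ℝ)) ^ (1 / 3 : ℝ) *
        (∫⁻ x in ball xB (R + ρ), (‖v x‖ₑ * ‖w x‖ₑ) ^ (3 / 2 : ℝ)) ^ (2 / 3 : ℝ) := by
  have h₀ : 0 < ρ / 2 := by positivity
  have h₁ : ρ / 2 < ρ := by linarith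
  set e := EuclideanSpace.basisFun (Fin 3) ℝ with he
  set B' : Set (EuclideanSpace ℝ (Fin 3)) := ball xB (R + ρ) with hB'
  set Θ : ℝ → EuclideanSpace ℝ (Fin 3) → ℝ := fun s => newtonNearPotential (ρ / 2) ρ (θ' s)
    with hΘdef
  have hΘ := hθ'.newtonNearPotential_slice h₀.le h₁
  have hΘ2 : ContDiff ℝ 2 (Θ t) := contDiff_infty.1 (hΘ.contDiff_slice t) 2
  have hθ2 : ContDiff ℝ 2 (θ' t) := contDiff_infty.1 (hθ'.contDiff_slice t) 2
  have hθc : HasCompactSupport (θ' t) := hθ'.hasCompactSupport_slice t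
  -- the entries of the Hessian
  set H : Fin 3 → Fin 3 → EuclideanSpace ℝ (Fin 3) → ℝ := fun i j x =>
    fderiv ℝ (fun y => fderiv ℝ (Θ t) y (e j)) x (e i) with hH
  have hHc : ∀ i j, Continuous (H i j) := fun i j =>
    (hΘ.continuous_fderiv_fderiv_slice (e j) (e i)).comp (Continuous.prodMk_right t)
  have hHeq : ∀ i j x, fderiv ℝ (fderiv ℝ (Θ t)) x (e i) (e j) = H i j x := fun i j x =>
    (fderiv_apply_const_apply_eq hΘ2 x (e j) (e i)).symm
  have hH0 : ∀ i j x, x ∉ B' → H i j x = 0 := by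
    intro i j x hx
    have hz : (t, x) ∉ tsupport (uncurry Θ) := fun h => hx (hΘ.tsupport_subset h).2
    exact fderiv_fderiv_slice_eq_zero_of_notMem_tsupport (ψ := Θ) hz _ _
  -- pointwise bound and support
  set F : EuclideanSpace ℝ (Fin 3) → ℝ := fun x =>
    fderiv ℝ (fderiv ℝ (Θ t)) x (v x) (w x) with hF
  have hFle : ∀ x, ‖F x‖ₑ ≤ ∑ i, ∑ j, ‖v x‖ₑ * ‖w x‖ₑ * ‖H i j x‖ₑ := fun x => by
    have := enorm_clm_apply_apply_le_sum (fderiv ℝ (fderiv ℝ (Θ t)) x) (v x) (w x)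
    simp only [← he, hHeq] at this
    exact this
  have hF0 : support (fun x => ‖F x‖ₑ) ⊆ B' := by
    intro x hx
    by_contra hxB
    refine hx ?_
    have : ‖F x‖ₑ ≤ 0 := by
      refine (hFle x).trans (le_of_eq ?_)
      simp [hH0 _ _ x hxB]
    exact nonpos_iff_eq_zero.1 this
  -- measurability
  set μ : Measure (EuclideanSpace ℝ (Fin 3)) := volume.restrict B' with hμ
  have hvw : AEMeasurable (fun x => ‖v x‖ₑ * ‖w x‖ₑ) μ := hv.enorm.mul hw.enorm
  have hHm : ∀ i j, AEMeasurable (fun x => ‖H i j x‖ₑ) μ := fun i j =>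
    (hHc i j).measurable.enorm.aemeasurable
  -- Step 1: `∫ ‖F‖ ≤ ∑ᵢⱼ ∫_{B'} |v||w| |Hᵢⱼ|`
  have step1 : ∫⁻ x, ‖F x‖ₑ ≤ ∑ i, ∑ j, ∫⁻ x, ‖v x‖ₑ * ‖w x‖ₑ * ‖H i j x‖ₑ ∂μ := by
    calc ∫⁻ x, ‖F x‖ₑ = ∫⁻ x in B', ‖F x‖ₑ := (setLIntegral_eq_of_support_subset hF0).symm
      _ ≤ ∫⁻ x in B', ∑ i, ∑ j, ‖v x‖ₑ * ‖w x‖ₑ * ‖H i j x‖ₑ := lintegral_mono hFle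
      _ = ∑ i, ∑ j, ∫⁻ x, ‖v x‖ₑ * ‖w x‖ₑ * ‖H i j x‖ₑ ∂μ := by
          have hg : ∀ i j, AEMeasurable (fun x => ‖v x‖ₑ * ‖w x‖ₑ * ‖H i j x‖ₑ) μ :=
            fun i j => hvw.mul (hHm i j)
          have hgi : ∀ i, AEMeasurable (fun x => ∑ j, ‖v x‖ₑ * ‖w x‖ₑ * ‖H i j x‖ₑ) μ :=
            fun i => Finset.aemeasurable_fun_sum _ fun j _ => hg i j
          rw [hμ, lintegral_finsetSum' _ fun i _ => hgi i]
          exact Finset.sum_congr rfl fun i _ => lintegral_finsetSum' _ fun j _ => hg i j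
  -- Step 2: Hölder with exponents `3/2`, `3`
  have hpq : Real.HolderConjugate (3 / 2) 3 :=
    Real.holderConjugate_iff.2 ⟨by norm_num, by norm_num⟩
  set U : ℝ≥0∞ := ∫⁻ x in B', (‖v x‖ₑ * ‖w x‖ₑ) ^ (3 / 2 : ℝ) with hU
  have step2 : ∀ i j, ∫⁻ x, ‖v x‖ₑ * ‖w x‖ₑ * ‖H i j x‖ₑ ∂μ ≤
      U ^ (2 / 3 : ℝ) * (∫⁻ x, ‖H i j x‖ₑ ^ (3 : ℝ) ∂μ) ^ (1 / 3 : ℝ) := fun i j => by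
    have h := ENNReal.lintegral_mul_le_Lp_mul_Lq μ hpq hvw (hHm i j)
    simp only [Pi.mul_apply] at h
    rw [show (1 : ℝ) / (3 / 2) = 2 / 3 by norm_num] at h
    exact h
  -- Step 3: the `L³` bound for the entries
  set T : ℝ≥0∞ := ∫⁻ x, ‖θ' t x‖ₑ ^ (3 : ℝ) with hT
  have e3 : ∀ g : EuclideanSpace ℝ (Fin 3) → ℝ,
      eLpNorm g 3 volume = (∫⁻ x, ‖g x‖ₑ ^ (3 : ℝ)) ^ (1 / 3 : ℝ) := fun g => by
    rw [eLpNorm_eq_lintegral_rpow_enorm_toReal (by norm_num) (by norm_num), ENNReal.toReal_ofNat]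
  have step3 : ∀ i j, (∫⁻ x, ‖H i j x‖ₑ ^ (3 : ℝ) ∂μ) ^ (1 / 3 : ℝ) ≤ C₃ * T ^ (1 / 3 : ℝ) :=
    fun i j => by
    have hei : ‖e i‖ ≤ 1 := (e.orthonormal.1 i).le
    have hej : ‖e j‖ ≤ 1 := (e.orthonormal.1 j).le
    have hst := hC₃ hρ hθ2 hθc (e j) (e i) hej hei
    rw [e3, e3] at hst
    calc (∫⁻ x, ‖H i j x‖ₑ ^ (3 : ℝ) ∂μ) ^ (1 / 3 : ℝ) ≤ (∫⁻ x, ‖H i j x‖ₑ ^ (3 : ℝ)) ^ (1 / 3 : ℝ) := by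
          gcongr
          exact Measure.restrict_le_self
      _ ≤ C₃ * T ^ (1 / 3 : ℝ) := hst
  -- Step 4: assemble
  calc ∫⁻ x, ‖F x‖ₑ ≤ ∑ i, ∑ j, ∫⁻ x, ‖v x‖ₑ * ‖w x‖ₑ * ‖H i j x‖ₑ ∂μ := step1
    _ ≤ ∑ _i : Fin 3, ∑ _j : Fin 3, U ^ (2 / 3 : ℝ) * (C₃ * T ^ (1 / 3 : ℝ)) :=
        Finset.sum_le_sum fun i _ => Finset.sum_le_sum fun j _ =>
          (step2 i j).trans (mul_le_mul' le_rfl (step3 i j))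
    _ = 9 * C₃ * T ^ (1 / 3 : ℝ) * U ^ (2 / 3 : ℝ) := by
        simp only [Finset.sum_const, Finset.card_univ, Fintype.card_fin, nsmul_eq_mul,
          Nat.cast_ofNat]
        ring

end SliceCZ

/-! ### The Calderón–Zygmund term at unit scale -/

section UnitScale

set_option maxHeartbeats 1600000 in
-- a long measure-theoretic assembly (slicing, Fubini, two Hölder steps); the bump covers this proof only
/-- **The Calderón–Zygmund term of Lemma 16.7 at unit scale.** Let `u` have the weak spatial
gradient `G` on `Q₁ = (-1, 0) × B₁` with `|u|² ∈ L¹_loc(Q₁)`, `A(1), E(1) < ∞`, and let `u` be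
weakly divergence free on `Q₁`. Let `0 < θ`, `0 < ρ`, `θ + ρ ≤ 1`, `θ² ≤ 1`,
`θ' ∈ C_c^∞((-θ², 0) × B_θ)` and `Θ(t,·) = N_{ρ/2,ρ}[θ'(t,·)]`. Then
`‖∫∫_{Q₁} D²Θ(u, u)‖ ≤ 9 C₃ C_SP A(1)^{1/2} E(1)^{1/2} θ^{1/3} ‖θ'‖_{L³}`, where `C₃` is a
Calderón–Zygmund constant at exponent `3` and `C_SP` a Sobolev–Poincaré constant for
`‖v - (v)₁‖_{L⁶(B₁)} ≤ C_SP ‖∇v‖_{L²(B₁)}` (Robinson–Rodrigo–Sadowski 2016, pp. 252–253: the mean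
`(u)₁(t)` is subtracted in the second slot for a.e. `t`, then
`‖u(u - (u)₁)‖_{L^{3/2}(B₁)} ≤ ‖u‖_{L²}‖u - (u)₁‖_{L⁶} ≤ C ‖u‖_{L²} ‖∇u‖_{L²}` and Hölder in time
over `(-θ², 0)`). [cite: RobinsonRodrigoSadowski2016, proof of Lemma 16.7 pp. 252–253] -/
theorem enorm_integral_hessian_le_meanZero_unitScale {C₃ : ℝ≥0}
    (hC₃ : ∀ ⦃r : ℝ⦄, 0 < r → ∀ ⦃g : EuclideanSpace ℝ (Fin 3) → ℝ⦄, ContDiff ℝ 2 g →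
      HasCompactSupport g → ∀ a b : EuclideanSpace ℝ (Fin 3), ‖a‖ ≤ 1 → ‖b‖ ≤ 1 →
        eLpNorm (fun x => fderiv ℝ (fun y => fderiv ℝ (newtonNearPotential (r / 2) r g) y a) x b)
            3 volume ≤ C₃ * eLpNorm g 3 volume)
    {CSP : ℝ≥0}
    (hCSP : ∀ (v : EuclideanSpace ℝ (Fin 3) → EuclideanSpace ℝ (Fin 3))
      (Dv : EuclideanSpace ℝ (Fin 3) → EuclideanSpace ℝ (Fin 3) →L[ℝ] EuclideanSpace ℝ (Fin 3)),
      FunctionSpaces.MemSobolevDomain 1 2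
        (⟨ball (0 : EuclideanSpace ℝ (Fin 3)) 1, isOpen_ball⟩ : Opens (EuclideanSpace ℝ (Fin 3)))
        volume v →
      FunctionSpaces.HasWeakFDerivOn
        (⟨ball (0 : EuclideanSpace ℝ (Fin 3)) 1, isOpen_ball⟩ : Opens (EuclideanSpace ℝ (Fin 3)))
        volume v Dv →
      eLpNorm (fun x => v x - ⨍ y in ball (0 : EuclideanSpace ℝ (Fin 3)) 1, v y) 6
          (volume.restrict (ball (0 : EuclideanSpace ℝ (Fin 3)) 1)) ≤
        CSP * eLpNorm Dv 2 (volume.restrict (ball (0 : EuclideanSpace ℝ (Fin 3)) 1)))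
    {u : ℝ → EuclideanSpace ℝ (Fin 3) → EuclideanSpace ℝ (Fin 3)}
    {G : ℝ → EuclideanSpace ℝ (Fin 3) → EuclideanSpace ℝ (Fin 3) →L[ℝ] EuclideanSpace ℝ (Fin 3)}
    (hG : HasWeakSpatialGradientOn (parabolicCylinderOpens 1 (0 : ℝ × EuclideanSpace ℝ (Fin 3))) u G)
    (hu2 : LocallyIntegrableOn (fun z : ℝ × EuclideanSpace ℝ (Fin 3) => ‖u z.1 z.2‖ ^ 2)
      (parabolicCylinder 1 (0 : ℝ × EuclideanSpace ℝ (Fin 3))) volume)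
    (hdiv : ∀ ϑ : ℝ → EuclideanSpace ℝ (Fin 3) → ℝ,
      IsSpaceTimeTestOn (parabolicCylinderOpens 1 (0 : ℝ × EuclideanSpace ℝ (Fin 3))) ϑ →
      ∫ z in parabolicCylinder 1 (0 : ℝ × EuclideanSpace ℝ (Fin 3)),
        ⟪u z.1 z.2, gradient (ϑ z.1) z.2⟫ = 0)
    (hA : cknAEss 1 0 u ≠ ∞) (hE : cknE 1 0 G ≠ ∞)
    {θ ρ : ℝ} (hθ : 0 < θ) (hρ : 0 < ρ) (hθρ : θ + ρ ≤ 1) (hθ1 : θ ^ 2 ≤ 1)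
    {θ' : ℝ → EuclideanSpace ℝ (Fin 3) → ℝ}
    (hθ' : IsSpaceTimeTestOn (⟨Ioo (-θ ^ 2) 0 ×ˢ ball (0 : EuclideanSpace ℝ (Fin 3)) θ,
      isOpen_Ioo.prod isOpen_ball⟩ : Opens (ℝ × EuclideanSpace ℝ (Fin 3))) θ') :
    ‖∫ z in parabolicCylinder 1 (0 : ℝ × EuclideanSpace ℝ (Fin 3)),
        fderiv ℝ (fderiv ℝ (newtonNearPotential (ρ / 2) ρ (θ' z.1))) z.2 (u z.1 z.2) (u z.1 z.2)‖ₑ ≤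
      9 * C₃ * CSP * cknAEss 1 0 u ^ (1 / 2 : ℝ) * cknE 1 0 G ^ (1 / 2 : ℝ) *
        ENNReal.ofReal θ ^ (1 / 3 : ℝ) *
        (∫⁻ z in Ioo (-θ ^ 2) 0 ×ˢ ball (0 : EuclideanSpace ℝ (Fin 3)) θ,
          ‖θ' z.1 z.2‖ₑ ^ (3 : ℝ)) ^ (1 / 3 : ℝ) := by
  have h₀ : 0 < ρ / 2 := by positivity
  have h₁ : ρ / 2 < ρ := by linarith
  -- ### sets
  set e := EuclideanSpace.basisFun (Fin 3) ℝ with he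
  set I : Set ℝ := Ioo (-1) 0 with hI
  set B : Set (EuclideanSpace ℝ (Fin 3)) := ball 0 1 with hB
  set Iθ : Set ℝ := Ioo (-θ ^ 2) 0 with hIθ
  set S : Set (ℝ × EuclideanSpace ℝ (Fin 3)) := Ioo (-θ ^ 2) 0 ×ˢ ball (0 : EuclideanSpace ℝ (Fin 3)) θ
    with hS
  set S' : Set (ℝ × EuclideanSpace ℝ (Fin 3)) :=
    Ioo (-θ ^ 2) 0 ×ˢ ball (0 : EuclideanSpace ℝ (Fin 3)) (θ + ρ) with hS'
  have hcyl : parabolicCylinder 1 (0 : ℝ × EuclideanSpace ℝ (Fin 3)) = I ×ˢ B := by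
    simp [parabolicCylinder, hI, hB]
  have hIθI : Iθ ⊆ I := Ioo_subset_Ioo (by linarith) le_rfl
  have hS'Q : S' ⊆ I ×ˢ B := prod_mono hIθI (ball_subset_ball hθρ)
  -- ### the potential `Θ` and its Hessian
  set Θ : ℝ → EuclideanSpace ℝ (Fin 3) → ℝ := fun t => newtonNearPotential (ρ / 2) ρ (θ' t)
    with hΘdef
  have hΘ := hθ'.newtonNearPotential_slice h₀.le h₁
  have hΘ2 : ∀ t, ContDiff ℝ 2 (Θ t) := fun t => contDiff_infty.1 (hΘ.contDiff_slice t) 2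
  set K : Set (ℝ × EuclideanSpace ℝ (Fin 3)) := tsupport (uncurry Θ) with hK
  have hKc : IsCompact K := hΘ.hasCompactSupport
  have hKS' : K ⊆ S' := hΘ.tsupport_subset
  have hKQ : K ⊆ I ×ˢ B := hKS'.trans hS'Q
  set L : ℝ → EuclideanSpace ℝ (Fin 3) →
      (EuclideanSpace ℝ (Fin 3) →L[ℝ] EuclideanSpace ℝ (Fin 3) →L[ℝ] ℝ) :=
    fun t x => fderiv ℝ (fderiv ℝ (Θ t)) x with hL
  have hL0 : ∀ z : ℝ × EuclideanSpace ℝ (Fin 3), z ∉ K → L z.1 z.2 = 0 := by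
    intro z hz
    ext d c
    rw [hL, ← fderiv_apply_const_apply_eq (hΘ2 z.1) z.2 c d]
    exact fderiv_fderiv_slice_eq_zero_of_notMem_tsupport (ψ := Θ) hz _ _
  -- the entries and a uniform bound
  set H : Fin 3 → Fin 3 → ℝ × EuclideanSpace ℝ (Fin 3) → ℝ := fun i j z => L z.1 z.2 (e i) (e j)
    with hH
  have hHc : ∀ i j, Continuous (H i j) := fun i j => by
    have := hΘ.continuous_fderiv_fderiv_slice (e j) (e i)
    refine this.congr fun z => ?_
    simp only [hH, hL]
    exact fderiv_apply_const_apply_eq (hΘ2 z.1) z.2 (e j) (e i)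
  have hH0 : ∀ i j z, z ∉ K → H i j z = 0 := fun i j z hz => by
    simp [hH, hL0 z hz]
  have hHbdd : ∀ i j, ∃ M, ∀ z, ‖H i j z‖ ≤ M := fun i j =>
    (hHc i j).bounded_above_of_compact_support (HasCompactSupport.intro hKc (hH0 i j))
  choose Mij hMij using hHbdd
  set M : ℝ := ∑ i, ∑ j, Mij i j with hM
  have hLM : ∀ (z : ℝ × EuclideanSpace ℝ (Fin 3)) (v w : EuclideanSpace ℝ (Fin 3)),
      ‖L z.1 z.2 v w‖ ≤ M * ‖v‖ * ‖w‖ := by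
    intro z v w
    refine (norm_clm_apply_apply_le_sum_mul (L z.1 z.2) v w).trans ?_
    gcongr
    rw [hM]
    exact Finset.sum_le_sum fun i _ => Finset.sum_le_sum fun j _ => hMij i j z
  have hM0 : 0 ≤ M := by
    have := hLM (0, 0) (e 0) (e 0)
    rw [e.orthonormal.1 0, mul_one, mul_one] at this
    exact (norm_nonneg _).trans this
  -- ### the integrand `F = D²Θ(u,u)` and its integrability
  set F : ℝ × EuclideanSpace ℝ (Fin 3) → ℝ := fun z => L z.1 z.2 (u z.1 z.2) (u z.1 z.2) with hF
  have hF0 : ∀ z, z ∉ K → F z = 0 := fun z hz => by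
    simp [hF, hL0 z hz]
  have hum : AEStronglyMeasurable (uncurry u) (volume.restrict (I ×ˢ B)) := by
    have := hG.locallyIntegrableOn.aestronglyMeasurable
    rwa [coe_parabolicCylinderOpens, hcyl] at this
  have hu2K : IntegrableOn (fun z : ℝ × EuclideanSpace ℝ (Fin 3) => ‖u z.1 z.2‖ ^ 2) K volume :=
    hu2.integrableOn_compact_subset (hcyl ▸ hKQ) hKc
  have hFexp : ∀ z, F z = ∑ i, ∑ j, ⟪u z.1 z.2, e i⟫ * ⟪u z.1 z.2, e j⟫ * H i j z := fun z =>
    clm_apply_apply_eq_sum_basisFun (L z.1 z.2) _ _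
  have hFint : Integrable F (volume : Measure (ℝ × EuclideanSpace ℝ (Fin 3))) := by
    have heq : F = fun z => ∑ i, ∑ j, ⟪u z.1 z.2, e i⟫ * ⟪u z.1 z.2, e j⟫ * H i j z := funext hFexp
    rw [heq]
    refine integrable_finsetSum _ fun i _ => integrable_finsetSum _ fun j _ => ?_
    -- dominated by `Mᵢⱼ 𝟙_K |u|²`, supported in `K ⊆ I × B`
    have hIB : IntegrableOn (fun z : ℝ × EuclideanSpace ℝ (Fin 3) =>
        ⟪u z.1 z.2, e i⟫ * ⟪u z.1 z.2, e j⟫ * H i j z) (I ×ˢ B) volume := by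
      have hmeas : AEStronglyMeasurable (fun z : ℝ × EuclideanSpace ℝ (Fin 3) =>
          ⟪u z.1 z.2, e i⟫ * ⟪u z.1 z.2, e j⟫ * H i j z) (volume.restrict (I ×ˢ B)) :=
        ((hum.inner aestronglyMeasurable_const).mul (hum.inner aestronglyMeasurable_const)).mul
          (hHc i j).aestronglyMeasurable
      refine Integrable.mono' (g := fun z => Mij i j * K.indicator
        (fun z : ℝ × EuclideanSpace ℝ (Fin 3) => ‖u z.1 z.2‖ ^ 2) z) ?_ hmeas (ae_of_all _ fun z => ?_)
      · exact (((integrable_indicator_iff hKc.isClosed.measurableSet).2 hu2K).const_mul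
          (Mij i j)).mono_measure Measure.restrict_le_self
      · by_cases hz : z ∈ K
        · rw [indicator_of_mem hz, norm_mul, norm_mul]
          have h1 : ‖⟪u z.1 z.2, e i⟫‖ ≤ ‖u z.1 z.2‖ :=
            (norm_inner_le_norm _ _).trans (by rw [e.orthonormal.1 i, mul_one])
          have h2 : ‖⟪u z.1 z.2, e j⟫‖ ≤ ‖u z.1 z.2‖ :=
            (norm_inner_le_norm _ _).trans (by rw [e.orthonormal.1 j, mul_one])
          calc ‖⟪u z.1 z.2, e i⟫‖ * ‖⟪u z.1 z.2, e j⟫‖ * ‖H i j z‖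
              ≤ ‖u z.1 z.2‖ * ‖u z.1 z.2‖ * Mij i j :=
                mul_le_mul (mul_le_mul h1 h2 (norm_nonneg _) (norm_nonneg _)) (hMij i j z)
                  (norm_nonneg _) (mul_nonneg (norm_nonneg _) (norm_nonneg _))
            _ = Mij i j * ‖u z.1 z.2‖ ^ 2 := by ring
        · rw [hH0 i j z hz, mul_zero, norm_zero, indicator_of_notMem hz, mul_zero]
    exact hIB.integrable_of_forall_notMem_eq_zero fun z hz => by
      rw [hH0 i j z (fun h => hz (hKQ h)), mul_zero]
  -- ### Fubini: `∫∫_{Q₁} F = ∫ (∫ F(t, x) dx) dt`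
  have hFint' : Integrable F ((volume : Measure ℝ).prod (volume : Measure (EuclideanSpace ℝ (Fin 3)))) := by
    rwa [← Measure.volume_eq_prod]
  have hFubini : ∫ z in parabolicCylinder 1 (0 : ℝ × EuclideanSpace ℝ (Fin 3)), F z =
      ∫ t, ∫ x, F (t, x) := by
    rw [setIntegral_eq_integral_of_forall_compl_eq_zero (fun z hz => hF0 z fun h =>
      hz (hcyl ▸ hKQ h)), Measure.volume_eq_prod, integral_prod F hFint']
  -- ### slice facts, a.e. in `t`
  set a : ℝ → ℝ≥0∞ := fun t => ∫⁻ x in B, ‖u t x‖ₑ ^ 2 with ha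
  set en : ℝ → ℝ≥0∞ := fun t => ∫⁻ x in B, ENNReal.ofReal (frobeniusNormSq (G t x)) with hen
  set T : ℝ → ℝ≥0∞ := fun t => ∫⁻ x, ‖θ' t x‖ₑ ^ (3 : ℝ) with hT
  set A := cknAEss 1 0 u with hAdef
  set EE := cknE 1 0 G with hEdef
  have hQI : Ioo ((0 : ℝ × EuclideanSpace ℝ (Fin 3)).1 - 1 ^ 2) (0 : ℝ × EuclideanSpace ℝ (Fin 3)).1 = I := by
    simp [hI]
  have hprod : (volume.restrict (I ×ˢ B) : Measure (ℝ × EuclideanSpace ℝ (Fin 3))) =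
      (volume.restrict I).prod (volume.restrict B) := by
    rw [Measure.volume_eq_prod, Measure.prod_restrict]
  have hGm : AEStronglyMeasurable (uncurry G) (volume.restrict (I ×ˢ B)) := by
    have := hG.locallyIntegrableOn_grad.aestronglyMeasurable
    rwa [coe_parabolicCylinderOpens, hcyl] at this
  have hGm2 : AEMeasurable (fun q : ℝ × EuclideanSpace ℝ (Fin 3) =>
      ENNReal.ofReal (frobeniusNormSq (G q.1 q.2))) ((volume.restrict I).prod (volume.restrict B)) := by
    rw [← hprod]
    exact (continuous_frobeniusNormSq'.comp_aestronglyMeasurable hGm).aemeasurable.ennreal_ofReal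
  have hEeq : EE = ∫⁻ t in I, en t := by
    rw [hEdef, cknE, ENNReal.ofReal_one, inv_one, one_mul, hcyl, Measure.volume_eq_prod,
      setLIntegral_prod _ (by rwa [← Measure.prod_restrict])]
  have henm : AEMeasurable en (volume.restrict I) := hGm2.lintegral_prod_right'
  have h2 : ∀ᵐ t ∂(volume.restrict I), en t < ∞ := by
    refine ae_lt_top' henm ?_
    rw [← hEeq]; exact hE
  have h3 : ∀ᵐ t ∂(volume.restrict I), FunctionSpaces.HasWeakFDerivOn
      (⟨B, isOpen_ball⟩ : Opens (EuclideanSpace ℝ (Fin 3))) volume (u t) (G t) := by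
    have := hG.ae_hasWeakFDerivOn_ball
    rwa [hQI] at this
  have h23 := (ae_restrict_iff' measurableSet_Ioo).1 (h2.and h3)
  obtain ⟨hslice, -, -⟩ := ae_slice_sq_facts hG hA
  -- divergence-free slices against the Hessian
  have hzero : ∀ᵐ t ∂(volume : Measure ℝ), ∀ k : Fin 3, ∫ x, L t x (u t x) (e k) = 0 := by
    have hΘQ : IsSpaceTimeTestOn (parabolicCylinderOpens 1 (0 : ℝ × EuclideanSpace ℝ (Fin 3))) Θ :=
      ⟨hΘ.contDiff, hΘ.hasCompactSupport, by
        rw [coe_parabolicCylinderOpens, hcyl]; exact hKQ⟩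
    exact ae_integral_hessian_apply_basisFun_eq_zero (Q := parabolicCylinderOpens 1 0)
      hG.locallyIntegrableOn hdiv hΘQ
  -- slices of `F` are integrable
  have hFslice : ∀ᵐ t ∂(volume : Measure ℝ), Integrable (fun x => F (t, x)) volume :=
    hFint'.prod_right_ae
  -- ### the slice-wise bound
  have hmain : ∀ᵐ t ∂(volume : Measure ℝ),
      ‖∫ x, F (t, x)‖ₑ ≤ Iθ.indicator (fun t => (9 * C₃ * CSP : ℝ≥0∞) * A ^ (1 / 2 : ℝ) *
        (en t ^ (1 / 2 : ℝ) * T t ^ (1 / 3 : ℝ))) t := by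
    filter_upwards [h23, hslice, hzero, hFslice] with t h23t hsl hz hFs
    by_cases htI : t ∈ Iθ
    swap
    · -- off `(-θ², 0)` the slice of `F` vanishes
      have hFt : ∀ x, F (t, x) = 0 := fun x => hF0 (t, x) fun h => htI (hKS' h).1
      simp only [hFt, integral_zero, enorm_zero, zero_le]
    rw [indicator_of_mem htI]
    have htI' : t ∈ I := hIθI htI
    obtain ⟨het, hwt⟩ := h23t htI'
    obtain ⟨hutm, hint2, hat, -⟩ := hsl htI'
    -- the slice `u(t)` on `B`
    haveI : IsFiniteMeasure (volume.restrict B) :=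
      isFiniteMeasure_restrict.2 measure_ball_lt_top.ne
    have hu2t : MemLp (u t) 2 (volume.restrict B) :=
      (memLp_two_iff_integrable_sq_norm hutm).2 hint2
    have hu1t : Integrable (u t) (volume.restrict B) := hu2t.integrable one_le_two
    set c : EuclideanSpace ℝ (Fin 3) := ⨍ y in B, u t y with hc
    -- integrability of `x ↦ D²Θ(t)(x)(u(t,x), w)` for fixed `w`, and of `F'`
    have hLt0 : ∀ x, x ∉ B → L t x = 0 := fun x hx => hL0 (t, x) fun h => hx (hKQ h).2
    have hmeasw : ∀ w : EuclideanSpace ℝ (Fin 3), AEStronglyMeasurable (fun x => L t x (u t x) w)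
        (volume.restrict B) := by
      intro w
      have heq : (fun x => L t x (u t x) w) = fun x => ∑ i, ∑ j, ⟪u t x, e i⟫ * ⟪w, e j⟫ * H i j (t, x) := by
        funext x; exact clm_apply_apply_eq_sum_basisFun (L t x) _ _
      rw [heq]
      refine Finset.aestronglyMeasurable_fun_sum _ fun i _ =>
        Finset.aestronglyMeasurable_fun_sum _ fun j _ => ?_
      exact ((hutm.inner aestronglyMeasurable_const).mul aestronglyMeasurable_const).mul
        ((hHc i j).comp (Continuous.prodMk_right t)).aestronglyMeasurable
    have hLw : ∀ w : EuclideanSpace ℝ (Fin 3), Integrable (fun x => L t x (u t x) w) volume := by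
      intro w
      have hIB : IntegrableOn (fun x => L t x (u t x) w) B volume := by
        refine Integrable.mono' (hu1t.norm.const_mul (M * ‖w‖)) (hmeasw w) (ae_of_all _ fun x => ?_)
        calc ‖L t x (u t x) w‖ ≤ M * ‖u t x‖ * ‖w‖ := hLM (t, x) _ _
          _ = M * ‖w‖ * ‖u t x‖ := by ring
      exact hIB.integrable_of_forall_notMem_eq_zero fun x hx => by
        simp [hLt0 x hx]
    -- Step A: subtract the mean in the second slot
    have hsplit : ∀ x, F (t, x) = L t x (u t x) (u t x - c) + L t x (u t x) c := fun x => by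
      simp only [hF, map_sub, sub_add_cancel]
    have hFc0 : ∫ x, L t x (u t x) c = 0 := by
      have hexp : ∀ x, L t x (u t x) c = ∑ k, ⟪c, e k⟫ * L t x (u t x) (e k) := by
        intro x
        have hcsum : c = ∑ k, ⟪c, e k⟫ • e k := by
          conv_lhs => rw [← e.sum_repr' c]
          exact Finset.sum_congr rfl fun k _ => by rw [real_inner_comm]
        conv_lhs => rw [hcsum]
        rw [map_sum]
        exact Finset.sum_congr rfl fun k _ => by rw [map_smul, smul_eq_mul]
      simp_rw [hexp]
      rw [integral_finsetSum _ fun k _ => (hLw (e k)).const_mul _]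
      refine Finset.sum_eq_zero fun k _ => ?_
      rw [integral_const_mul, hz k, mul_zero]
    have hF'int : Integrable (fun x => L t x (u t x) (u t x - c)) volume := by
      have : (fun x => L t x (u t x) (u t x - c)) = fun x => F (t, x) - L t x (u t x) c := by
        funext x; rw [hsplit x]; ring
      rw [this]
      exact hFs.sub (hLw c)
    have hStepA : ∫ x, F (t, x) = ∫ x, L t x (u t x) (u t x - c) := by
      simp_rw [hsplit]
      rw [integral_add hF'int (hLw c), hFc0, add_zero]
    -- Step B: the slice-wise Calderón–Zygmund bound
    have hvm : AEStronglyMeasurable (u t) (volume.restrict (ball (0 : EuclideanSpace ℝ (Fin 3)) (θ + ρ))) :=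
      hutm.mono_measure (Measure.restrict_mono (ball_subset_ball hθρ) le_rfl)
    have hwm : AEStronglyMeasurable (fun x => u t x - c)
        (volume.restrict (ball (0 : EuclideanSpace ℝ (Fin 3)) (θ + ρ))) := hvm.sub aestronglyMeasurable_const
    have hStepB := lintegral_hessian_newtonNearPotential_apply_le hC₃ hρ hθ' t hvm hwm
    -- Step C: Hölder `(2, 6)` on `B₁` and the Sobolev–Poincaré inequality
    have hsob : FunctionSpaces.MemSobolevDomain 1 2
        (⟨B, isOpen_ball⟩ : Opens (EuclideanSpace ℝ (Fin 3))) volume (u t) := by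
      have hGtm : AEStronglyMeasurable (G t) (volume.restrict B) :=
        hwt.locallyIntegrableOn_deriv.aestronglyMeasurable
      have hg2 : MemLp (G t) 2 (volume.restrict B) :=
        ⟨hGtm, (eLpNorm_two_le_lintegral_frobeniusNormSq_rpow _ _).trans_lt
          (ENNReal.rpow_lt_top_of_nonneg (by norm_num) het.ne)⟩
      refine FunctionSpaces.memSobolevDomain_succ_iff.2 ⟨hu2t, G t, hwt, fun v => ?_⟩
      rw [FunctionSpaces.memSobolevDomain_zero_iff]
      exact (ContinuousLinearMap.apply ℝ (EuclideanSpace ℝ (Fin 3)) v).comp_memLp' hg2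
    have hSP : eLpNorm (fun x => u t x - c) 6 (volume.restrict B) ≤ CSP * en t ^ (1 / 2 : ℝ) :=
      (hCSP (u t) (G t) hsob hwt).trans (by
        gcongr; exact eLpNorm_two_le_lintegral_frobeniusNormSq_rpow _ _)
    have hStepC : (∫⁻ x in ball (0 : EuclideanSpace ℝ (Fin 3)) (θ + ρ),
        (‖u t x‖ₑ * ‖u t x - c‖ₑ) ^ (3 / 2 : ℝ)) ^ (2 / 3 : ℝ) ≤
        a t ^ (1 / 2 : ℝ) * (CSP * en t ^ (1 / 2 : ℝ)) := by
      have hmono : (∫⁻ x in ball (0 : EuclideanSpace ℝ (Fin 3)) (θ + ρ),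
          (‖u t x‖ₑ * ‖u t x - c‖ₑ) ^ (3 / 2 : ℝ)) ≤
          ∫⁻ x in B, (‖u t x‖ₑ * ‖u t x - c‖ₑ) ^ (3 / 2 : ℝ) := lintegral_mono_set (ball_subset_ball hθρ)
      refine (ENNReal.rpow_le_rpow hmono (by norm_num)).trans ?_
      have hH := lintegral_mul_rpow_threeHalves_le (volume.restrict B) (f := fun x => ‖u t x‖ₑ)
        (g := fun x => ‖u t x - c‖ₑ) hutm.enorm
        (hutm.sub (aestronglyMeasurable_const (b := c))).enorm
      refine hH.trans ?_
      have e1 : (∫⁻ x in B, ‖u t x‖ₑ ^ (2 : ℝ)) ^ (1 / 2 : ℝ) = a t ^ (1 / 2 : ℝ) := by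
        rw [ha]
        congr 1
        refine lintegral_congr fun x => ?_
        rw [show (2 : ℝ) = ((2 : ℕ) : ℝ) by norm_num, ENNReal.rpow_natCast]
      have e2 : (∫⁻ x in B, ‖u t x - c‖ₑ ^ (6 : ℝ)) ^ (1 / 6 : ℝ) =
          eLpNorm (fun x => u t x - c) 6 (volume.restrict B) := by
        rw [eLpNorm_eq_lintegral_rpow_enorm_toReal (by norm_num) (by norm_num), ENNReal.toReal_ofNat]
      rw [e1, e2]
      gcongr
    -- assemble the slice bound
    calc ‖∫ x, F (t, x)‖ₑ = ‖∫ x, L t x (u t x) (u t x - c)‖ₑ := by rw [hStepA]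
      _ ≤ ∫⁻ x, ‖L t x (u t x) (u t x - c)‖ₑ := enorm_integral_le_lintegral_enorm _
      _ ≤ 9 * C₃ * T t ^ (1 / 3 : ℝ) * (∫⁻ x in ball (0 : EuclideanSpace ℝ (Fin 3)) (θ + ρ),
            (‖u t x‖ₑ * ‖u t x - c‖ₑ) ^ (3 / 2 : ℝ)) ^ (2 / 3 : ℝ) := hStepB
      _ ≤ 9 * C₃ * T t ^ (1 / 3 : ℝ) * (a t ^ (1 / 2 : ℝ) * (CSP * en t ^ (1 / 2 : ℝ))) := by gcongr
      _ ≤ 9 * C₃ * T t ^ (1 / 3 : ℝ) * (A ^ (1 / 2 : ℝ) * (CSP * en t ^ (1 / 2 : ℝ))) := by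
          gcongr
      _ = (9 * C₃ * CSP : ℝ≥0∞) * A ^ (1 / 2 : ℝ) * (en t ^ (1 / 2 : ℝ) * T t ^ (1 / 3 : ℝ)) := by
          ring
  -- ### integrate the slice bound in time
  have hTm : Measurable T := by
    have : Measurable fun z : ℝ × EuclideanSpace ℝ (Fin 3) => ‖θ' z.1 z.2‖ₑ ^ (3 : ℝ) :=
      (hθ'.contDiff.continuous.measurable.enorm.pow_const _)
    exact this.lintegral_prod_right'
  have henmθ : AEMeasurable en (volume.restrict Iθ) :=
    henm.mono_measure (Measure.restrict_mono hIθI le_rfl)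
  have hT0 : ∀ t, t ∉ Iθ → T t = 0 := by
    intro t ht
    have h0 : (fun x => ‖θ' t x‖ₑ ^ (3 : ℝ)) = fun _ => 0 := funext fun x => by
      rw [hθ'.apply_eq_zero (fun h => ht h.1), enorm_zero, ENNReal.zero_rpow_of_pos (by norm_num)]
    show ∫⁻ x, ‖θ' t x‖ₑ ^ (3 : ℝ) = 0
    rw [h0, lintegral_zero]
  have hTtot : ∫⁻ t in Iθ, T t = ∫⁻ z in S, ‖θ' z.1 z.2‖ₑ ^ (3 : ℝ) := by
    have hmeas : AEMeasurable (fun z : ℝ × EuclideanSpace ℝ (Fin 3) => ‖θ' z.1 z.2‖ₑ ^ (3 : ℝ))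
        ((volume : Measure ℝ).prod (volume : Measure (EuclideanSpace ℝ (Fin 3)))) := by
      rw [← Measure.volume_eq_prod]
      exact (hθ'.contDiff.continuous.measurable.enorm.pow_const _).aemeasurable
    have hsupp : support (fun z : ℝ × EuclideanSpace ℝ (Fin 3) => ‖θ' z.1 z.2‖ₑ ^ (3 : ℝ)) ⊆ S := by
      intro z hz
      by_contra hzS
      have h0 : θ' z.1 z.2 = 0 := hθ'.apply_eq_zero hzS
      exact hz (by simp [h0, ENNReal.zero_rpow_of_pos (by norm_num : (0 : ℝ) < 3)])
    have hsuppT : support T ⊆ Iθ := fun t ht => by_contra fun h => ht (hT0 t h)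
    calc ∫⁻ t in Iθ, T t = ∫⁻ t, T t := setLIntegral_eq_of_support_subset hsuppT
      _ = ∫⁻ z : ℝ × EuclideanSpace ℝ (Fin 3), ‖θ' z.1 z.2‖ₑ ^ (3 : ℝ) := by
          rw [Measure.volume_eq_prod, lintegral_prod _ hmeas]
      _ = ∫⁻ z in S, ‖θ' z.1 z.2‖ₑ ^ (3 : ℝ) := (setLIntegral_eq_of_support_subset hsupp).symm
  have hvolIθ : volume Iθ = ENNReal.ofReal (θ ^ 2) := by
    rw [hIθ, Real.volume_Ioo]; congr 1; ring
  calc ‖∫ z in parabolicCylinder 1 (0 : ℝ × EuclideanSpace ℝ (Fin 3)), F z‖ₑ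
      = ‖∫ t, ∫ x, F (t, x)‖ₑ := by rw [hFubini]
    _ ≤ ∫⁻ t, ‖∫ x, F (t, x)‖ₑ := enorm_integral_le_lintegral_enorm _
    _ ≤ ∫⁻ t, Iθ.indicator (fun t => (9 * C₃ * CSP : ℝ≥0∞) * A ^ (1 / 2 : ℝ) *
        (en t ^ (1 / 2 : ℝ) * T t ^ (1 / 3 : ℝ))) t := lintegral_mono_ae hmain
    _ = (9 * C₃ * CSP : ℝ≥0∞) * A ^ (1 / 2 : ℝ) * ∫⁻ t in Iθ, en t ^ (1 / 2 : ℝ) * T t ^ (1 / 3 : ℝ) := by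
        rw [lintegral_indicator measurableSet_Ioo, lintegral_const_mul' _ _ (ENNReal.mul_ne_top
          (by simp [ENNReal.mul_ne_top]) (ENNReal.rpow_ne_top_of_nonneg (by norm_num) hA))]
    _ ≤ (9 * C₃ * CSP : ℝ≥0∞) * A ^ (1 / 2 : ℝ) * ((∫⁻ t in Iθ, en t) ^ (1 / 2 : ℝ) *
        (∫⁻ t in Iθ, T t ^ (2 / 3 : ℝ)) ^ (1 / 2 : ℝ)) := by
        gcongr
        -- Cauchy–Schwarz `∫ e^{1/2} T^{1/3} ≤ (∫ e)^{1/2} (∫ T^{2/3})^{1/2}`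
        have h22 : (2 : ℝ).HolderConjugate 2 := Real.holderConjugate_iff.2 ⟨by norm_num, by norm_num⟩
        have k1 := ENNReal.lintegral_mul_le_Lp_mul_Lq (volume.restrict Iθ) h22
          (henmθ.pow_const (1 / 2 : ℝ)) (hTm.aemeasurable.pow_const (1 / 3 : ℝ))
        have e1 : ∀ x, (en x ^ (1 / 2 : ℝ)) ^ (2 : ℝ) = en x := fun x => by
          rw [← ENNReal.rpow_mul]; norm_num
        have e2 : ∀ x, (T x ^ (1 / 3 : ℝ)) ^ (2 : ℝ) = T x ^ (2 / 3 : ℝ) := fun x => by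
          rw [← ENNReal.rpow_mul]; norm_num
        simp only [Pi.mul_apply, e1, e2] at k1
        exact k1
    _ ≤ (9 * C₃ * CSP : ℝ≥0∞) * A ^ (1 / 2 : ℝ) * (EE ^ (1 / 2 : ℝ) *
        ((∫⁻ t in Iθ, T t) ^ (2 / 3 : ℝ) * volume Iθ ^ (1 / 3 : ℝ)) ^ (1 / 2 : ℝ)) := by
        gcongr
        · rw [hEeq]; exact lintegral_mono_set hIθI
        · have := setLIntegral_rpow_le_rpow_mul_measure volume Iθ hTm.aemeasurable.restrict
            (a := 2 / 3) (b := 1) (by norm_num) (by norm_num)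
          simp only [ENNReal.rpow_one] at this
          convert this using 2 <;> norm_num
    _ = 9 * C₃ * CSP * A ^ (1 / 2 : ℝ) * EE ^ (1 / 2 : ℝ) * ENNReal.ofReal θ ^ (1 / 3 : ℝ) *
        (∫⁻ z in S, ‖θ' z.1 z.2‖ₑ ^ (3 : ℝ)) ^ (1 / 3 : ℝ) := by
        rw [hTtot, hvolIθ, ENNReal.ofReal_pow hθ.le, ENNReal.mul_rpow_of_nonneg _ _ (by norm_num),
          ← ENNReal.rpow_mul, ← ENNReal.rpow_natCast, ← ENNReal.rpow_mul, ← ENNReal.rpow_mul]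
        push_cast
        norm_num
        ring

end UnitScale

end Literature.Analysis.FluidPDE
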